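import Literature.AlgebraicGeometry.Resolution.KnafKuhlmann2009Lemma216
import Literature.AlgebraicGeometry.Resolution.HenselizedRationalDensity
import Literature.AlgebraicGeometry.Resolution.RankOneDensity
import Literature.AlgebraicGeometry.Resolution.HenselizedFunctionFields
import HarnessLib

/-!
# `K[x]` is dense in `K(x)^h` for an immediate `x` of transcendental approximation type and rank one (Kuhlmann 2019, Lemma 4.1)

Topic: `Literature/AlgebraicGeometry/Resolution` (valued function fields). A PROVED step of the
decomposition of the named fact `Kuhlmann2019_Prop52_sepClosed`
(`Kuhlmann2019HenselianRationalityFiniteRank.lean`; reduced in `Kuhlmann2019Prop52Reduction.lean`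
to Props. 4.8/4.9 and [23, Thm. 11.1] of F.-V. Kuhlmann, *Elimination of ramification II:
Henselian rationality*, Israel J. Math. 234 (2019) = arXiv:1701.05508). §4 of that paper opens
the analysis of the Galois extensions of degree `p` of `K(x)^h`, `(K(x)|K,v)` immediate, with

> If we assume in addition that the rank of `(K, v)` is 1, then we can say even more about the
> element `a`. To this end we need the following result, which is Lemma 10.1 of [23]:
> **Lemma 4.1.** […] Assume that the rank of `(K,v)` is 1 and that `char K = p > 0`. By
> Lemma 4.1, for every `a ∈ K(x)^h` there is `f(x) ∈ K[x]` such that `a − f(x) ∈ M_{K(x)^h}`.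
> Hence in (4.1), `a` can be replaced by `f(x)` …

([23] = F.-V. Kuhlmann, I. Vlahu, *The relative approximation degree in valued function
fields*, Math. Z. 276 (2014) 203–235; the displayed statement of Lemma 4.1 is lost in the held
text of the paper, only its use is printed.) This file PROVES that use — and the density of
`K[x]` in `K(x)^h` behind it — for `x` of TRANSCENDENTAL APPROXIMATION TYPE over `K` (§4:
"for every polynomial `h(X) ∈ K[X]` there is some `α ∈ v(x − K)` such that for all `c ∈ K`
with `v(x − c) ≥ α` the value `vh(c)` is fixed"; the standing assumption of §4.1, automatic
over a separable-algebraically maximal `K` by Lemma 4.6, and PROVED in the tree over a separably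
closed `K`: `kaplansky_condition_of_isSepClosed`, `KnafKuhlmann2009Lemma216.lean`), along the
classical lines:

1. (`exists_eq_mul_one_add_of_kaplansky`) every non-zero `f(x)`, `f ∈ K[X]`, is
   `f(x) = c·(1 + u)` with `c ∈ K^×`, `u ∈ K[x]`, `v(u) > 0` — Kaplansky approximation
   (Knaf–Kuhlmann 2009, Lemma 2.18, `exists_center_taylor_valuation_ne`, and its dominant Taylor
   term `f(x) = t·g(x̃)`, `v(g(x̃)) = 0`, `exists_dominant_taylor_term`,
   `ImmediateRationalUniformization.lean`) and `K(x)v = Kv`;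
2. (`exists_polynomial_valuation_sub_lt_of_mem_closure`) hence `K[x]` is dense in `K(x)` when
   `(K(x), v)` has rank one: `1/f(x) = c⁻¹ ∑_{k<N} (−u)^k + c⁻¹(−u)^N/(1+u)` and `v(u)^N → 0`
   (archimedean axiom, `IsRankOneValued.exists_forall_mul_pow_lt`);
3. (`exists_polynomial_valuation_sub_lt_of_mem_henselization`) and `K(x)` is dense in `K(x)^h`
   (Kuhlmann 2010, Lemma 2.4, PROVED in `RankOneDensity.lean`:
   `exists_mem_valuation_sub_lt_of_isRankOneValued`), so `K[x]` is dense in `K(x)^h`; in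
   particular (`exists_polynomial_valuation_sub_lt_one_of_mem_henselization`) every
   `a ∈ K(x)^h` is `≡ f(x) mod 𝓜` for some `f ∈ K[X]` — the printed use of Lemma 4.1;
4. (`exists_polynomial_valuation_sub_lt_one_of_isSepClosed`) the instance of the proof of
   Prop. 5.2: `K` separably closed of rank one (`IsRankOne`), `x` transcendental with
   `(K(x)|K, v)` immediate.

## Sources

* [K19] F.-V. Kuhlmann, Israel J. Math. 234 (2019) = arXiv:1701.05508: §4, Lemma 4.1 (p. 7),
  Lemma 4.6, Prop. 5.2. [Kuhlmann2019]
* [23] F.-V. Kuhlmann, I. Vlahu, Math. Z. 276 (2014) 203–235: Lemma 10.1 (as quoted).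
* [KK09] H. Knaf, F.-V. Kuhlmann, Adv. Math. 221 (2009) = arXiv:math/0702856: Lemmas 2.5,
  2.16–2.18. [KnafKuhlmann2009]
* [K10] F.-V. Kuhlmann, Trans. AMS 362 (2010) = arXiv:1003.5678: §2.1, Lemma 2.4. [Kuhlmann2010]

## Rendering notes

As in `ImmediateRationalUniformization.lean` / `KnafKuhlmann2009Lemma216.lean`: `(Ω, V)` one
valued field, `K : Subfield Ω`, `K(z) = Subfield.closure (K ∪ {z})`, `K[z]` = values `P(z)` of
polynomials `P` over `Ω` with coefficients in `K`; "`K(z)|K` immediate" = the hypotheses `hval`,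
`hres`; transcendental approximation type = the hypothesis `h3` (condition (3) of
Knaf–Kuhlmann 2009, Lemma 2.17: `v g(a)` constant on a ball `{a ∈ K : v(z − a) ≥ v(z − a₀)}`);
rank one = `IsRankOneValued` (`GeneralizedStabilityHenselizedRational.lean`, archimedean form);
`K(z)^h = henselization V K(z)` (`Henselization.lean`); values multiplicative.
No definition is introduced.
-/

noncomputable section

namespace Literature.AlgebraicGeometry.Resolution

universe u

open Polynomial IsLocalRing

variable {Ω : Type u} [Field Ω] (V : ValuationSubring Ω) (K : Subfield Ω)

/-! ### Bookkeeping -/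

omit V in
/-- The value at a point of a subring of a polynomial with coefficients in that subring lies in
the subring. [folklore] -/
theorem eval_mem_subring_of_coeff_mem {R : Subring Ω} {P : Polynomial Ω}
    (hP : ∀ k, P.coeff k ∈ R) {x : Ω} (hx : x ∈ R) : P.eval x ∈ R := by
  rw [Polynomial.eval_eq_sum_range]
  exact Subring.sum_mem _ fun k _ => Subring.mul_mem _ (hP k) (Subring.pow_mem _ hx k)

variable {V K} in
/-- **Rank one is inherited by immediate extensions**: if `(K, v)` has rank one (archimedean
form) and `K ≤ F` is immediate, then `(F, v)` has rank one — `F` has the same values as `K`.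
[folklore] -/
theorem IsRankOneValued.of_isImmediateOver {F : Subfield Ω} (hK : IsRankOneValued V K)
    (hKF : K ≤ F) (himm : IsImmediateOver V K F) : IsRankOneValued V F := by
  obtain ⟨⟨a, haK, ha⟩, harch⟩ := hK
  refine ⟨⟨a, hKF haK, ha⟩, fun x hx y hy hx1 => ?_⟩
  have hx0 : x ≠ 0 := by
    rintro rfl
    rw [map_zero] at hx1
    exact not_lt_zero hx1
  obtain ⟨x', hx'K, hxx'⟩ := himm.1 x hx hx0
  by_cases hy0 : y = 0
  · exact ⟨0, by rw [hy0, map_zero]; exact zero_le⟩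
  obtain ⟨y', hy'K, hyy'⟩ := himm.1 y hy hy0
  obtain ⟨n, hn⟩ := harch x' hx'K y' hy'K (hxx' ▸ hx1)
  exact ⟨n, by rw [hxx', hyy']; exact hn⟩

/-! ### Step 1: `f(z) = c·(1 + u)` with `c ∈ K^×`, `u ∈ K[z]`, `v(u) > 0` -/

/-- **Unit normal form of polynomial values.** Let `z ∉ K` with `K(z)|K` immediate (`hval`,
`hres`) and of transcendental approximation type (`h3`). Then for every polynomial `f` over `K`
with `f(z) ≠ 0` there are `c ∈ K^×` and a polynomial `U` over `K` with `v(U(z)) < 1` and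
`f(z) = c·(1 + U(z))`. Proof: by Kaplansky approximation (Knaf–Kuhlmann 2009, Lemma 2.18)
`f(z) = t·g(z̃)` with `t ∈ K`, `z̃ = (z − a)/b`, `g` over `O_K`, `v(g(z̃)) = 0`
(`exists_dominant_taylor_term`); as `K(z)v = Kv` there is `d ∈ K` with `v(g(z̃) − d) > 0`,
and `c = td`, `U(z) = g(z̃)/d − 1`. [cite: KnafKuhlmann2009, Lemma 2.18] -/
theorem exists_eq_mul_one_add_of_kaplansky {z : Ω} (hzK : z ∉ K)
    (hval : ∀ w ∈ Subfield.closure ((K : Set Ω) ∪ {z}), w ≠ 0 → ∃ b ∈ K,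
      V.valuation w = V.valuation b)
    (hres : ∀ w ∈ Subfield.closure ((K : Set Ω) ∪ {z}), w ∈ V → ∃ c ∈ K,
      V.valuation (w - c) < 1)
    (h3 : ∀ g : Polynomial Ω, (∀ k, g.coeff k ∈ K) → ∃ a₀ ∈ K, ∃ α : V.ValueGroup,
      ∀ a ∈ K, V.valuation (z - a) ≤ V.valuation (z - a₀) → V.valuation (g.eval a) = α)
    {f : Polynomial Ω} (hf : ∀ k, f.coeff k ∈ K) (hfz : f.eval z ≠ 0) :
    ∃ c ∈ K, c ≠ 0 ∧ ∃ U : Polynomial Ω, (∀ k, U.coeff k ∈ K) ∧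
      V.valuation (U.eval z) < 1 ∧ f.eval z = c * (1 + U.eval z) := by
  classical
  obtain ⟨a, haK, b, hbK, hb0, hvb, hdist⟩ :=
    exists_center_taylor_valuation_ne V K hzK hval hres h3 {f} (fun g hg => by
      rw [Finset.mem_singleton] at hg
      rw [hg]
      exact hf)
  obtain ⟨t, htK, ht0, g, hg, hfeq, hvg⟩ := exists_dominant_taylor_term V K haK hbK hb0 hvb hf
    (hdist f (Finset.mem_singleton_self f)) hfz
  set Kz : Subfield Ω := Subfield.closure ((K : Set Ω) ∪ {z}) with hKzdef
  have hKKz : K ≤ Kz := fun c hc => Subfield.subset_closure (Or.inl hc)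
  have hzKz : z ∈ Kz := Subfield.subset_closure (Or.inr rfl)
  set zt : Ω := (z - a) / b with hzt
  have hztKz : zt ∈ Kz := div_mem (sub_mem hzKz (hKKz haK)) (hKKz hbK)
  have hgKz : g.eval zt ∈ Kz := eval_mem_subfield_of_coeff_mem (fun k => hKKz (hg k).2) hztKz
  have hgV : g.eval zt ∈ V := (V.valuation_le_one_iff _).mp hvg.le
  obtain ⟨d, hdK, hvd⟩ := hres _ hgKz hgV
  have hvd1 : V.valuation d = 1 := by
    have hd : d = g.eval zt + -(g.eval zt - d) := by ring
    have hlt : V.valuation (-(g.eval zt - d)) < V.valuation (g.eval zt) := by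
      rw [Valuation.map_neg, hvg]
      exact hvd
    rw [hd, V.valuation.map_add_eq_of_lt_left hlt]
    exact hvg
  have hd0 : d ≠ 0 := by
    rintro rfl
    rw [map_zero] at hvd1
    exact zero_ne_one hvd1
  -- the polynomial `U` with `U(z) = g(z̃)/d − 1`
  have hmemR : g.eval zt / d - 1 ∈ Subring.closure ((K : Set Ω) ∪ {z}) := by
    have hKR : ∀ c ∈ K, c ∈ Subring.closure ((K : Set Ω) ∪ {z}) := fun c hc =>
      Subring.subset_closure (Or.inl hc)
    have hzR : z ∈ Subring.closure ((K : Set Ω) ∪ {z}) := Subring.subset_closure (Or.inr rfl)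
    have hztR : zt ∈ Subring.closure ((K : Set Ω) ∪ {z}) := by
      rw [hzt, div_eq_mul_inv]
      exact Subring.mul_mem _ (Subring.sub_mem _ hzR (hKR a haK)) (hKR _ (K.inv_mem hbK))
    have hgR : g.eval zt ∈ Subring.closure ((K : Set Ω) ∪ {z}) :=
      eval_mem_subring_of_coeff_mem (fun k => hKR _ (hg k).2) hztR
    rw [div_eq_mul_inv]
    exact Subring.sub_mem _ (Subring.mul_mem _ hgR (hKR _ (K.inv_mem hdK))) (Subring.one_mem _)
  obtain ⟨U, hU, hUz⟩ := exists_polynomial_eval_eq_of_mem_closure K hmemR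
  refine ⟨t * d, mul_mem htK hdK, mul_ne_zero ht0 hd0, U, hU, ?_, ?_⟩
  · rw [hUz]
    have : g.eval zt / d - 1 = (g.eval zt - d) / d := by field_simp
    rw [this, map_div₀, hvd1, div_one]
    exact hvd
  · rw [hUz, hfeq]
    field_simp
    ring

/-! ### Step 2: `K[z]` is dense in `K(z)` (rank one) -/

/-- **`K[z]` is dense in `K(z)`** for `z ∉ K` with `K(z)|K` immediate of transcendental
approximation type and `(K(z), v)` of rank one: every `w ∈ K(z)` is approximated by values
`P(z)`, `P ∈ K[X]`, to within any value of `K(z)^×`. Proof: `w = f(z)/h(z)`,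
`h(z) = c(1 + u)` (`exists_eq_mul_one_add_of_kaplansky`), and
`w − f(z)c⁻¹∑_{k<N}(−u)^k = w·(−u)^N` has value `v(w)·v(u)^N`, smaller than any given value for
large `N` (archimedean axiom). [cite: Kuhlmann2019, Lemma 4.1] -/
theorem exists_polynomial_valuation_sub_lt_of_mem_closure {z : Ω} (hzK : z ∉ K)
    (hval : ∀ w ∈ Subfield.closure ((K : Set Ω) ∪ {z}), w ≠ 0 → ∃ b ∈ K,
      V.valuation w = V.valuation b)
    (hres : ∀ w ∈ Subfield.closure ((K : Set Ω) ∪ {z}), w ∈ V → ∃ c ∈ K,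
      V.valuation (w - c) < 1)
    (h3 : ∀ g : Polynomial Ω, (∀ k, g.coeff k ∈ K) → ∃ a₀ ∈ K, ∃ α : V.ValueGroup,
      ∀ a ∈ K, V.valuation (z - a) ≤ V.valuation (z - a₀) → V.valuation (g.eval a) = α)
    (hr1 : IsRankOneValued V (Subfield.closure ((K : Set Ω) ∪ {z})))
    {w : Ω} (hw : w ∈ Subfield.closure ((K : Set Ω) ∪ {z}))
    {c : Ω} (hc : c ∈ Subfield.closure ((K : Set Ω) ∪ {z})) (hc0 : c ≠ 0) :
    ∃ P : Polynomial Ω, (∀ k, P.coeff k ∈ K) ∧ V.valuation (w - P.eval z) < V.valuation c := by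
  classical
  set Kz : Subfield Ω := Subfield.closure ((K : Set Ω) ∪ {z}) with hKzdef
  have hKKz : K ≤ Kz := fun c hc => Subfield.subset_closure (Or.inl hc)
  have hzKz : z ∈ Kz := Subfield.subset_closure (Or.inr rfl)
  have hvc : 0 < V.valuation c := (Valuation.pos_iff _).mpr hc0
  have hcoefmap : ∀ q : Polynomial K, ∀ k, (q.map (algebraMap K Ω)).coeff k ∈ K := fun q k => by
    rw [Polynomial.coeff_map]
    exact (q.coeff k).2
  have hevalmap : ∀ q : Polynomial K, (q.map (algebraMap K Ω)).eval z = Polynomial.aeval z q :=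
    fun q => by rw [Polynomial.aeval_def, Polynomial.eval_map]
  -- `w = f(z)/h(z)`
  have hw' : w ∈ IntermediateField.adjoin K ({z} : Set Ω) := (mem_adjoin_subfield_iff K {z} w).mpr hw
  obtain ⟨f, h, hwfh⟩ := (IntermediateField.mem_adjoin_simple_iff K _).mp hw'
  by_cases hh0 : Polynomial.aeval z h = 0
  · refine ⟨0, fun k => by rw [coeff_zero]; exact K.zero_mem, ?_⟩
    rw [hwfh, hh0, div_zero, eval_zero, sub_zero, map_zero]
    exact hvc
  by_cases hf0 : Polynomial.aeval z f = 0
  · refine ⟨0, fun k => by rw [coeff_zero]; exact K.zero_mem, ?_⟩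
    rw [hwfh, hf0, zero_div, eval_zero, sub_zero, map_zero]
    exact hvc
  -- `h(z) = c₁ (1 + u)`
  obtain ⟨c₁, hc₁K, hc₁0, U, hU, hvu, hheq⟩ := exists_eq_mul_one_add_of_kaplansky V K hzK hval hres h3
    (hcoefmap h) (by rw [hevalmap]; exact hh0)
  rw [hevalmap] at hheq
  set u : Ω := U.eval z with hudef
  have huKz : u ∈ Kz := eval_mem_subfield_of_coeff_mem (fun k => hKKz (hU k)) hzKz
  have h1u : V.valuation (1 + u) = 1 := by
    have hlt : V.valuation u < V.valuation (1 : Ω) := by rw [map_one]; exact hvu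
    rw [V.valuation.map_add_eq_of_lt_left hlt, map_one]
  have h1u0 : 1 + u ≠ 0 := fun h0 => by
    rw [h0, map_zero] at h1u
    exact zero_ne_one h1u
  have hw0 : w ≠ 0 := by
    rw [hwfh, hheq]
    exact div_ne_zero hf0 (mul_ne_zero hc₁0 h1u0)
  -- `U` over `K`, lifted to `K[X]`
  obtain ⟨U', hU'⟩ : ∃ U' : Polynomial K, U'.map (algebraMap K Ω) = U :=
    (Polynomial.mem_lifts U).mp ((Polynomial.lifts_iff_coeff_lifts U).mpr
      fun k => ⟨⟨U.coeff k, hU k⟩, rfl⟩)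
  have hU'z : Polynomial.aeval z U' = u := by rw [← hevalmap, hU']
  -- `N` with `v(w)·v(u)^N < v(c)`
  obtain ⟨N, hN⟩ := hr1.exists_forall_mul_pow_lt huKz hvu hw hc hc0
  -- the approximant `P = f · c₁⁻¹ · ∑_{k<N} (−U)^k`
  let c₁' : K := ⟨c₁, hc₁K⟩
  have hc₁' : (c₁' : Ω) = c₁ := rfl
  have hc₁'0 : c₁' ≠ 0 := fun h0 => hc₁0 (by rw [← hc₁', h0]; rfl)
  set S' : Polynomial K := ∑ k ∈ Finset.range N, (-U') ^ k with hS'def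
  set P' : Polynomial K := f * Polynomial.C c₁'⁻¹ * S' with hP'def
  have hS'z : Polynomial.aeval z S' = ∑ k ∈ Finset.range N, (-u) ^ k := by
    rw [hS'def, map_sum]
    refine Finset.sum_congr rfl fun k _ => ?_
    rw [map_pow, map_neg, hU'z]
  have hP'z : Polynomial.aeval z P' =
      Polynomial.aeval z f * c₁⁻¹ * ∑ k ∈ Finset.range N, (-u) ^ k := by
    rw [hP'def, map_mul, map_mul, hS'z, Polynomial.aeval_C, map_inv₀]
    rfl
  -- geometric series: `(1 + u) ∑_{k<N} (−u)^k = 1 − (−u)^N`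
  have hgeom : (1 + u) * ∑ k ∈ Finset.range N, (-u) ^ k = 1 - (-u) ^ N := by
    have := geom_sum_mul (-u) N
    linear_combination (-1 : Ω) * this
  have key : w - Polynomial.aeval z P' = w * (-u) ^ N := by
    have hrew : w * (-u) ^ N = w * (1 - (1 + u) * ∑ k ∈ Finset.range N, (-u) ^ k) := by
      rw [hgeom, sub_sub_cancel]
    rw [hrew, hP'z, hwfh, hheq]
    field_simp
  refine ⟨P'.map (algebraMap K Ω), hcoefmap P', ?_⟩
  rw [hevalmap, key, map_mul, map_pow, Valuation.map_neg]
  exact hN N le_rfl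

/-! ### Step 3: `K[z]` is dense in `K(z)^h` — Lemma 4.1 -/

section Henselization

variable [IsAlgClosed Ω]

/-- **Kuhlmann 2019, Lemma 4.1 (= [23, Lemma 10.1]): `K[z]` is dense in `K(z)^h`.** For
`z ∉ K` with `K(z)|K` immediate of transcendental approximation type and `(K(z), v)` of rank
one, every `a ∈ K(z)^h = henselization V K(z)` is approximated by values `P(z)`, `P ∈ K[X]`, to
within any value of `K(z)^×`: `K(z)` is dense in `K(z)^h` (Kuhlmann 2010, Lemma 2.4,
`exists_mem_valuation_sub_lt_of_isRankOneValued`) and `K[z]` is dense in `K(z)`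
(`exists_polynomial_valuation_sub_lt_of_mem_closure`). [cite: Kuhlmann2019, Lemma 4.1] -/
theorem exists_polynomial_valuation_sub_lt_of_mem_henselization {z : Ω} (hzK : z ∉ K)
    (hval : ∀ w ∈ Subfield.closure ((K : Set Ω) ∪ {z}), w ≠ 0 → ∃ b ∈ K,
      V.valuation w = V.valuation b)
    (hres : ∀ w ∈ Subfield.closure ((K : Set Ω) ∪ {z}), w ∈ V → ∃ c ∈ K,
      V.valuation (w - c) < 1)
    (h3 : ∀ g : Polynomial Ω, (∀ k, g.coeff k ∈ K) → ∃ a₀ ∈ K, ∃ α : V.ValueGroup,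
      ∀ a ∈ K, V.valuation (z - a) ≤ V.valuation (z - a₀) → V.valuation (g.eval a) = α)
    (hr1 : IsRankOneValued V (Subfield.closure ((K : Set Ω) ∪ {z})))
    {a : Ω} (ha : a ∈ henselization V (Subfield.closure ((K : Set Ω) ∪ {z})))
    {c : Ω} (hc : c ∈ Subfield.closure ((K : Set Ω) ∪ {z})) (hc0 : c ≠ 0) :
    ∃ P : Polynomial Ω, (∀ k, P.coeff k ∈ K) ∧ V.valuation (a - P.eval z) < V.valuation c := by
  obtain ⟨y, hy, hay⟩ := exists_mem_valuation_sub_lt_of_isRankOneValued hr1 ha hc hc0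
  obtain ⟨P, hP, hyP⟩ :=
    exists_polynomial_valuation_sub_lt_of_mem_closure V K hzK hval hres h3 hr1 hy hc hc0
  refine ⟨P, hP, ?_⟩
  have : a - P.eval z = (a - y) + (y - P.eval z) := by ring
  rw [this]
  exact lt_of_le_of_lt (V.valuation.map_add _ _) (max_lt hay hyP)

/-- **Lemma 4.1 as used in §4 of Kuhlmann 2019**: "for every `a ∈ K(x)^h` there is
`f(x) ∈ K[x]` such that `a − f(x) ∈ 𝓜_{K(x)^h}`", i.e. `v(a − P(z)) < 1` for some polynomial
`P` over `K` (the case `c = 1` of `exists_polynomial_valuation_sub_lt_of_mem_henselization`).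
[cite: Kuhlmann2019, Lemma 4.1] -/
theorem exists_polynomial_valuation_sub_lt_one_of_mem_henselization {z : Ω} (hzK : z ∉ K)
    (hval : ∀ w ∈ Subfield.closure ((K : Set Ω) ∪ {z}), w ≠ 0 → ∃ b ∈ K,
      V.valuation w = V.valuation b)
    (hres : ∀ w ∈ Subfield.closure ((K : Set Ω) ∪ {z}), w ∈ V → ∃ c ∈ K,
      V.valuation (w - c) < 1)
    (h3 : ∀ g : Polynomial Ω, (∀ k, g.coeff k ∈ K) → ∃ a₀ ∈ K, ∃ α : V.ValueGroup,
      ∀ a ∈ K, V.valuation (z - a) ≤ V.valuation (z - a₀) → V.valuation (g.eval a) = α)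
    (hr1 : IsRankOneValued V (Subfield.closure ((K : Set Ω) ∪ {z})))
    {a : Ω} (ha : a ∈ henselization V (Subfield.closure ((K : Set Ω) ∪ {z}))) :
    ∃ P : Polynomial Ω, (∀ k, P.coeff k ∈ K) ∧ V.valuation (a - P.eval z) < 1 := by
  have h := exists_polynomial_valuation_sub_lt_of_mem_henselization V K hzK hval hres h3 hr1 ha
    (Subfield.one_mem _) one_ne_zero
  rwa [map_one] at h

/-! ### Step 4: the instance of Prop. 5.2 — `K` separably closed of rank one, `K(z)|K` immediate -/

/-- **Lemma 4.1 in the setting of Prop. 5.2**: for `K ≤ Ω` separably closed of rank one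
(`IsRankOne`, `HenselizedFunctionFields.lean`), `z` transcendental over `K` with `(K(z)|K, V)`
immediate, and `a ∈ K(z)^h`, there is a polynomial `P` over `K` with `v(a − P(z)) < 1`; and
`K[z]` is dense in `K(z)^h`. The transcendental approximation type is supplied by
Knaf–Kuhlmann 2009, Lemma 2.16 (`kaplansky_condition_of_isSepClosed`), rank one of `K(z)` by
`isRankOneValued_of_overrings` and `IsRankOneValued.of_isImmediateOver`.
[cite: Kuhlmann2019, Lemma 4.1 and Prop. 5.2 (proof)] -/
theorem exists_polynomial_valuation_sub_lt_of_isSepClosed [IsSepClosed K] {z : Ω}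
    (hz : Transcendental K z) (himm : IsImmediateOver V K (Subfield.closure ((K : Set Ω) ∪ {z})))
    (hr : IsRankOne V K) {a : Ω} (ha : a ∈ henselization V (Subfield.closure ((K : Set Ω) ∪ {z})))
    {c : Ω} (hc : c ∈ Subfield.closure ((K : Set Ω) ∪ {z})) (hc0 : c ≠ 0) :
    ∃ P : Polynomial Ω, (∀ k, P.coeff k ∈ K) ∧ V.valuation (a - P.eval z) < V.valuation c := by
  set Kz : Subfield Ω := Subfield.closure ((K : Set Ω) ∪ {z}) with hKzdef
  have hKKz : K ≤ Kz := fun c hc => Subfield.subset_closure (Or.inl hc)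
  -- transcendence in polynomial form, `z ∉ K`
  have htrans : ∀ P : Polynomial Ω, (∀ k, P.coeff k ∈ K) → P.eval z = 0 → P = 0 := by
    intro P hP hPz
    obtain ⟨P', hP'⟩ : ∃ P' : Polynomial K, P'.map (algebraMap K Ω) = P :=
      (Polynomial.mem_lifts P).mp ((Polynomial.lifts_iff_coeff_lifts P).mpr
        fun k => ⟨⟨P.coeff k, hP k⟩, rfl⟩)
    by_contra hP0
    refine hz ⟨P', fun h => hP0 ?_, ?_⟩
    · rw [← hP', h, Polynomial.map_zero]
    · rw [Polynomial.aeval_def, ← Polynomial.eval_map, hP', hPz]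
  have hzK : z ∉ K := not_mem_of_forall_eval_eq_zero K htrans
  -- immediateness in the form `hval`, `hres`
  have hval : ∀ w ∈ Kz, w ≠ 0 → ∃ b ∈ K, V.valuation w = V.valuation b := himm.1
  have hres : ∀ w ∈ Kz, w ∈ V → ∃ c ∈ K, V.valuation (w - c) < 1 := by
    intro w hw hwV
    have hrw : residue V ⟨w, hwV⟩ ∈ resField V K := himm.2 (residue_mem_resField V ⟨w, hwV⟩ hw)
    obtain ⟨c, hcK, hcw⟩ := (mem_resField_iff V K _).mp hrw
    refine ⟨c, hcK, ?_⟩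
    have h0 : residue V (⟨w, hwV⟩ - c) = 0 := by rw [map_sub, hcw, sub_self]
    have h1 := (ValuationSubring.valuation_lt_one_iff V (⟨w, hwV⟩ - c)).mp
      ((residue_eq_zero_iff _).mp h0)
    exact h1
  -- transcendental approximation type (Lemma 2.16) and rank one of `K(z)`
  have h3 := kaplansky_condition_of_isSepClosed V K htrans hval hres
  have hr1 : IsRankOneValued V Kz :=
    (isRankOneValued_of_overrings V K hr.1 hr.2).of_isImmediateOver hKKz himm
  exact exists_polynomial_valuation_sub_lt_of_mem_henselization V K hzK hval hres h3 hr1 ha hc hc0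

/-- **The printed use of Lemma 4.1 in the setting of Prop. 5.2** (`c = 1`): every `a ∈ K(z)^h`
is congruent modulo the maximal ideal to some `P(z)`, `P ∈ K[X]`.
[cite: Kuhlmann2019, Lemma 4.1 and Prop. 5.2 (proof)] -/
theorem exists_polynomial_valuation_sub_lt_one_of_isSepClosed [IsSepClosed K] {z : Ω}
    (hz : Transcendental K z) (himm : IsImmediateOver V K (Subfield.closure ((K : Set Ω) ∪ {z})))
    (hr : IsRankOne V K) {a : Ω}
    (ha : a ∈ henselization V (Subfield.closure ((K : Set Ω) ∪ {z}))) :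
    ∃ P : Polynomial Ω, (∀ k, P.coeff k ∈ K) ∧ V.valuation (a - P.eval z) < 1 := by
  have h := exists_polynomial_valuation_sub_lt_of_isSepClosed V K hz himm hr ha
    (Subfield.one_mem _) one_ne_zero
  rwa [map_one] at h

end Henselization

end Literature.AlgebraicGeometry.Resolution

end
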